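import Literature.Uncategorized.Crux
import Literature.Topology.FourManifolds.KirbyMovesMirrorProofs
import Literature.Topology.FourManifolds.SliceGenusMirrorProofs
import Literature.Topology.FourManifolds.SliceGenusEqZeroIffProofs
import Literature.Topology.FourManifolds.RasmussenConcordanceProofs
import Literature.Topology.FourManifolds.ZeroSurgeryHomotopyBallSliceProofs

/-!
# Mirror closure of `SVanishesOnPairs`: the pair relation is orientation-blind and one inequality suffices (negative lemmas for crux stmt-SmoothPoincare4-0368)

Crux `ZeroSurgeryExotic.ZseSVanishesOnPairs` (item `stmt-SmoothPoincare4-0368`) is, verbatim, the tree's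
registered open statement `Literature.Uncategorized.SVanishesOnPairs` (on a `0`-surgery pair `(K, K')` with
`K` smoothly slice, every Rasmussen invariant of `K'` vanishes).  This file (standing disprover, cdisprove
gen 2) proves UNCONDITIONALLY, from three facts already PROVED in the tree —
`FramedLink.IsSurgery.mirror` (surgery on the mirrored framed link, `KirbyMovesMirrorProofs`),
`Knot.sliceGenus_mirror_holds` with `Knot.sliceGenus_eq_zero_iff_holds` (`g₄(K̄) = g₄(K)`, `g₄ = 0 ↔ slice`)
and `HasRasmussenInvariant.mirror_holds` (`s(K̄) = -s(K)`):

* `isIntegralSurgery_mirror` — if `Y` is `m`-surgery on `K` then the SAME (unoriented) `Y` is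
  `(-m)`-surgery on the mirror image `K̄` (any charted space `Y`); hence `isIntegralSurgery_zero_mirror_iff`
  and `zeroSurgeryPair_self_mirror`: EVERY knot is a `0`-friend of its mirror image in the tree's sense —
  the pair relation of the crux is orientation-blind (it contains all `K'` with `S³₀(K') ≅ -S³₀(K)`);
* `isSmoothlySlice_mirror_iff` — `K̄` is slice iff `K` is;
* `sVanishesOnPairs_iff_nonpos`, `sVanishesOnPairs_iff_nonneg` — the RIGOROUS MIRROR CLOSURE: the crux is
  equivalent to each of its one-sided forms (`s(K') ≤ 0`, resp. `0 ≤ s(K')`, on pairs with `K` slice), so a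
  proof need only establish one inequality (typically the negative-definite / `#ᵗℂℙ²bar` one);
* `exists_pos_and_neg_of_not_sVanishesOnPairs` — counterexamples come in mirror pairs (one with `s > 0`,
  one with `s < 0`).
No definitions; no route item is concluded positively (only equivalences between forms of the open statement).
-/

noncomputable section

set_option linter.dupNamespace false

open scoped Manifold ContDiff
open Literature.Topology.FourManifolds Literature.Uncategorized

namespace Summit.SmoothPoincare4.SmoothPoincare4.Theorems.ZseSVanishesOnPairs.Negative

/-- **Mirror of the one-component framed link**: `(K, m)` mirrored is `(K̄, -m)`. [folklore] -/
theorem framedLink_single_mirror (K : Knot) (m : ℤ) :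
    (FramedLink.single K m).mirror = FramedLink.single K.mirror (-m) := by
  simp only [FramedLink.mirror, FramedLink.single]
  congr 1

/-- **`m`-surgery on `K` is `(-m)`-surgery on the mirror image `K̄`, for the same unoriented `Y`**
(any charted space `Y`): the proved `FramedLink.IsSurgery.mirror` transported through
`FramedLink.isSurgery_single_iff`. [cite: GompfStipsicz1999, §5.1] -/
theorem isIntegralSurgery_mirror {Y : Type} [TopologicalSpace Y]
    [ChartedSpace (EuclideanSpace ℝ (Fin 3)) Y] {K : Knot} {m : ℤ} (h : IsIntegralSurgery (𝓡 3) Y K m) :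
    IsIntegralSurgery (𝓡 3) Y K.mirror (-m) := by
  rw [← FramedLink.isSurgery_single_iff] at h ⊢
  rw [← framedLink_single_mirror]
  exact h.mirror

/-- `Y` is `0`-surgery on `K̄` iff it is `0`-surgery on `K`. [cite: GompfStipsicz1999, §5.1] -/
theorem isIntegralSurgery_zero_mirror_iff {Y : Type} [TopologicalSpace Y]
    [ChartedSpace (EuclideanSpace ℝ (Fin 3)) Y] (K : Knot) :
    IsIntegralSurgery (𝓡 3) Y K.mirror 0 ↔ IsIntegralSurgery (𝓡 3) Y K 0 := by
  constructor
  · intro h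
    have h' := isIntegralSurgery_mirror h
    rwa [neg_zero, show K.mirror.mirror = K from SphereEmbedding.mirror_mirror K] at h'
  · intro h
    have h' := isIntegralSurgery_mirror h
    rwa [neg_zero] at h'

/-- **Every knot is a `0`-friend of its mirror image in the tree's (unoriented) sense**: whenever `Y`
is `0`-surgery on `K`, the triple `(K, K̄, Y)` satisfies the pair hypotheses of the crux
(`S³₀(K̄) = -S³₀(K)` and `IsIntegralSurgery` sees no orientation). The crux's pair relation is thus
orientation-blind; every line must survive `K' = K̄`. [cite: GompfStipsicz1999, §5.1] -/
theorem zeroSurgeryPair_self_mirror {Y : Type} [TopologicalSpace Y]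
    [ChartedSpace (EuclideanSpace ℝ (Fin 3)) Y] {K : Knot} (h : IsIntegralSurgery (𝓡 3) Y K 0) :
    IsIntegralSurgery (𝓡 3) Y K 0 ∧ IsIntegralSurgery (𝓡 3) Y K.mirror 0 :=
  ⟨h, (isIntegralSurgery_zero_mirror_iff K).2 h⟩

/-- **Sliceness is mirror-invariant** (`g₄(K̄) = g₄(K)` and `g₄ = 0 ↔ slice`, both proved).
[cite: Livingston2005, §9.5] -/
theorem isSmoothlySlice_mirror {K : Knot} (h : K.IsSmoothlySlice) : K.mirror.IsSmoothlySlice := by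
  rw [← Knot.sliceGenus_eq_zero_iff_holds] at h ⊢
  rw [Knot.sliceGenus_mirror_holds K]
  exact h

/-- `K̄` is smoothly slice iff `K` is. [cite: Livingston2005, §9.5] -/
theorem isSmoothlySlice_mirror_iff (K : Knot) : K.mirror.IsSmoothlySlice ↔ K.IsSmoothlySlice :=
  ⟨fun h ↦ by
      have h' := isSmoothlySlice_mirror h
      rwa [show K.mirror.mirror = K from SphereEmbedding.mirror_mirror K] at h',
    isSmoothlySlice_mirror⟩

/-- **The four hypotheses of the crux are closed under simultaneous mirror image**, the Rasmussen
invariant being negated (`HasRasmussenInvariant.mirror_holds`, proved). [folklore] -/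
theorem pair_mirror {K K' : Knot} {Y : Type} [TopologicalSpace Y]
    [ChartedSpace (EuclideanSpace ℝ (Fin 3)) Y] {s : ℤ}
    (h1 : IsIntegralSurgery (𝓡 3) Y K 0) (h2 : IsIntegralSurgery (𝓡 3) Y K' 0)
    (h3 : K.IsSmoothlySlice) (h4 : K'.HasRasmussenInvariant s) :
    IsIntegralSurgery (𝓡 3) Y K.mirror 0 ∧ IsIntegralSurgery (𝓡 3) Y K'.mirror 0 ∧
      K.mirror.IsSmoothlySlice ∧ K'.mirror.HasRasmussenInvariant (-s) :=
  ⟨(isIntegralSurgery_zero_mirror_iff K).2 h1, (isIntegralSurgery_zero_mirror_iff K').2 h2,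
    isSmoothlySlice_mirror h3, HasRasmussenInvariant.mirror_holds h4⟩

/-- **MIRROR CLOSURE (≤): the crux is equivalent to its one-sided form `s(K') ≤ 0` on `0`-surgery
pairs with `K` slice** — unconditional. So a proof of the crux need only establish ONE inequality.
[cite: ManolescuMarengonSarkarWillis2023, Cor. 1.13] -/
theorem sVanishesOnPairs_iff_nonpos : SVanishesOnPairs ↔
    ∀ (K K' : Knot) (Y : Type) [TopologicalSpace Y] [ChartedSpace (EuclideanSpace ℝ (Fin 3)) Y]
      (s : ℤ), IsIntegralSurgery (𝓡 3) Y K 0 → IsIntegralSurgery (𝓡 3) Y K' 0 → K.IsSmoothlySlice →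
        K'.HasRasmussenInvariant s → s ≤ 0 := by
  constructor
  · intro h K K' Y _ _ s h1 h2 h3 h4
    exact (h K K' Y s h1 h2 h3 h4).le
  · intro h K K' Y _ _ s h1 h2 h3 h4
    obtain ⟨m1, m2, m3, m4⟩ := pair_mirror h1 h2 h3 h4
    have hle : s ≤ 0 := h K K' Y s h1 h2 h3 h4
    have hge : -s ≤ 0 := h K.mirror K'.mirror Y (-s) m1 m2 m3 m4
    omega

/-- **MIRROR CLOSURE (≥): the crux is equivalent to its one-sided form `0 ≤ s(K')`** — unconditional.
[cite: ManolescuMarengonSarkarWillis2023, Cor. 1.13] -/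
theorem sVanishesOnPairs_iff_nonneg : SVanishesOnPairs ↔
    ∀ (K K' : Knot) (Y : Type) [TopologicalSpace Y] [ChartedSpace (EuclideanSpace ℝ (Fin 3)) Y]
      (s : ℤ), IsIntegralSurgery (𝓡 3) Y K 0 → IsIntegralSurgery (𝓡 3) Y K' 0 → K.IsSmoothlySlice →
        K'.HasRasmussenInvariant s → 0 ≤ s := by
  constructor
  · intro h K K' Y _ _ s h1 h2 h3 h4
    exact (h K K' Y s h1 h2 h3 h4).ge
  · intro h K K' Y _ _ s h1 h2 h3 h4
    obtain ⟨m1, m2, m3, m4⟩ := pair_mirror h1 h2 h3 h4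
    have hge : 0 ≤ s := h K K' Y s h1 h2 h3 h4
    have hle : 0 ≤ -s := h K.mirror K'.mirror Y (-s) m1 m2 m3 m4
    omega

/-- **Counterexamples come in mirror pairs**: if the crux fails there is a `0`-surgery pair with `K`
slice and `s(K') > 0` and one with `s(K') < 0` (unconditional). [folklore] -/
theorem exists_pos_and_neg_of_not_sVanishesOnPairs (h : ¬ SVanishesOnPairs) :
    (∃ (K K' : Knot) (Y : Type) (_ : TopologicalSpace Y) (_ : ChartedSpace (EuclideanSpace ℝ (Fin 3)) Y)
      (s : ℤ), IsIntegralSurgery (𝓡 3) Y K 0 ∧ IsIntegralSurgery (𝓡 3) Y K' 0 ∧ K.IsSmoothlySlice ∧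
        K'.HasRasmussenInvariant s ∧ 0 < s) ∧
    (∃ (K K' : Knot) (Y : Type) (_ : TopologicalSpace Y) (_ : ChartedSpace (EuclideanSpace ℝ (Fin 3)) Y)
      (s : ℤ), IsIntegralSurgery (𝓡 3) Y K 0 ∧ IsIntegralSurgery (𝓡 3) Y K' 0 ∧ K.IsSmoothlySlice ∧
        K'.HasRasmussenInvariant s ∧ s < 0) := by
  obtain ⟨K, K', Y, _, _, s, h1, h2, h3, h4, h5⟩ := not_not.1 (mt not_crux_iff_sVanishesOnPairs.1 h)
  obtain ⟨m1, m2, m3, m4⟩ := pair_mirror h1 h2 h3 h4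
  rcases lt_or_gt_of_ne h5 with hs | hs
  · exact ⟨⟨K.mirror, K'.mirror, Y, _, _, -s, m1, m2, m3, m4, by omega⟩,
      ⟨K, K', Y, _, _, s, h1, h2, h3, h4, hs⟩⟩
  · exact ⟨⟨K, K', Y, _, _, s, h1, h2, h3, h4, hs⟩,
      ⟨K.mirror, K'.mirror, Y, _, _, -s, m1, m2, m3, m4, by omega⟩⟩

end Summit.SmoothPoincare4.SmoothPoincare4.Theorems.ZseSVanishesOnPairs.Negative
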